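import Summits.CriticalPhenomena.PercolationContinuityZ3.Theorems.PercNearOneGluingNoHeavyLowerTailLightnessDiamond
import Summits.CriticalPhenomena.PercolationContinuityZ3.Theorems.PercNearOneGluingNoHeavyLowerTailLonelyObserver
import Summits.CriticalPhenomena.PercolationContinuityZ3.Theorems.PercNearOneGluingNoHeavyLowerTailHalfLeSevenForms
import HarnessLib

/-!
# `NoHeavyLowerTail` (stmt-CriticalPhenomena-4575) — the rung `CIL(5,2)` with constant `5/2`, for every weighted graph

Support file (prover `prim-lf-4`, lemma factory "LP-duality"; `--supports stmt-CriticalPhenomena-4575`).  No definitions,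
no named facts, no sorries.

For `μ = prodBernoulli w` on `Fin n`, a relay set `A` with `|A| = 5`, a champion `c ∈ A` at level `2`
(`μ(|π(a)| ≤ 2) ≤ μ(|π(c)| ≤ 2)` for all `a ∈ A`, `π(v) = A.filter (v ↔ ·)`) and any observer `o`:

  `μ(1 ≤ |π(o)| ≤ 2) ≤ (5/2) · μ(|π(c)| ≤ 2)`                               (`cil_five_two_le`),

and in general, at the half level (`1 ≤ j`, `2 ≤ |A| ≤ 2j + 1`):  `μ(1 ≤ |π(o)| ≤ j) ≤ (|A|/2) · μ(|π(c)| ≤ j)`   (`cil_halfLevel_le_half_card`).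

The open rung `CIL(5,2)` of the cumulative isolation lemma asks for the constant `1`; this is the first analytic bound with a
constant valid for ALL weights and supports (the kernel certificate `CertH13` gives `3/2` on the glued-pair sub-family).  Proof
(memo DIAMOND-STAR.md §4): split `{1 ≤ N ≤ 2}` by the lightness of `c`; the part with `c` light lies in `R_c`; the singleton
part with `c` heavy is `≤ μ(N ≥ 3, o ↮ c) ⊆ R_c` by THEOREM A (`lonelyObserver_le_bigBlock`, Kozma–Nitzan packing); the pair part
with `c` heavy counted twice, plus the singleton part counted once, is at most the sum over `x ≠ c` of the `x`-star cuts
`μ({o↔x} ∩ R_x ∩ R_cᶜ) ≤ μ({o↔x} ∩ R_xᶜ ∩ R_c)` (the lightness diamond of BHK 2006 Thm 1.5 + the champion rows, `reach_light_heavy_le'`; = `sum_reach_light_heavy_le` of the DiamondStar file), whose right side is at most `4 · μ(N ≥ 3, c light)`.  So `bad₁ ≤ G`, `bad₁ + 2 bad₂ ≤ 4 G` with `G = μ(N ≥ 3, c light)`,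
hence `bad₁ + bad₂ ≤ (5/2) G`, and `μ(1 ≤ N ≤ 2, c light) + G ≤ μ(R_c)`.  Total `≤ (5/2) μ(R_c)`.
-/

noncomputable section

namespace Summit.CriticalPhenomena.PercolationContinuityZ3.Theorems

open MeasureTheory Set
open Literature.Probability.LatticeModels (prodBernoulli)
open Literature.Probability.Percolation
open LightnessDiamond
open scoped Classical BigOperators

variable {n : ℕ}

namespace CILFiveTwoConst

/-- If `o ↮ c` then `π(o)` and `π(c)` are disjoint subsets of `A`, so `|π(o)| + |π(c)| ≤ |A|`. [folklore] -/
theorem card_add_card_le (A : Finset (Fin n)) (o c : Fin n) {ω : BondConfig (Fin n)}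
    (h : ω ∉ (openConn o c : Set (BondConfig (Fin n)))) :
    (A.filter fun z => ω ∈ openConn o z).card + (A.filter fun z => ω ∈ openConn c z).card ≤ A.card := by
  rw [← Finset.card_union_of_disjoint]
  · exact Finset.card_le_card (Finset.union_subset (Finset.filter_subset _ _) (Finset.filter_subset _ _))
  · rw [Finset.disjoint_left]
    intro z hzo hzc
    have h1 : (openGraph ω).Reachable o z := (Finset.mem_filter.1 hzo).2
    have h2 : (openGraph ω).Reachable c z := (Finset.mem_filter.1 hzc).2
    exact h (h1.trans h2.symm)

/-- The `x`-star cut (`Theorems.reach_light_heavy_le` of the DiamondStar file, re-derived here from `lightnessDiamond` so that this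
file does not depend on that module): for `x ≠ c` with `μ(R_x) ≤ μ(R_c)`,
`μ({o ↔ x} ∩ R_x ∩ R_cᶜ) ≤ μ({o ↔ x} ∩ R_xᶜ ∩ R_c)`. [this file] -/
theorem reach_light_heavy_le' (w : Sym2 (Fin n) → unitInterval) (A : Finset (Fin n)) (o x c : Fin n) (j : ℕ)
    (hxc : x ≠ c)
    (hK : (prodBernoulli w).real {ω : BondConfig (Fin n) | (A.filter fun z => ω ∈ openConn x z).card ≤ j} ≤
      (prodBernoulli w).real {ω : BondConfig (Fin n) | (A.filter fun z => ω ∈ openConn c z).card ≤ j}) :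
    (prodBernoulli w).real ((openConn o x : Set (BondConfig (Fin n))) ∩
        {ω : BondConfig (Fin n) | (A.filter fun z => ω ∈ openConn x z).card ≤ j} ∩
        {ω : BondConfig (Fin n) | (A.filter fun z => ω ∈ openConn c z).card ≤ j}ᶜ) ≤
      (prodBernoulli w).real ((openConn o x : Set (BondConfig (Fin n))) ∩
        {ω : BondConfig (Fin n) | (A.filter fun z => ω ∈ openConn x z).card ≤ j}ᶜ ∩
        {ω : BondConfig (Fin n) | (A.filter fun z => ω ∈ openConn c z).card ≤ j}) := by
  set μ := prodBernoulli w with hμ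
  set Rx : Set (BondConfig (Fin n)) := {ω | (A.filter fun z => ω ∈ openConn x z).card ≤ j} with hRx
  set Rc : Set (BondConfig (Fin n)) := {ω | (A.filter fun z => ω ∈ openConn c z).card ≤ j} with hRc
  set Q : Set (BondConfig (Fin n)) := openConn o x with hQ
  have hmeas : ∀ S : Set (BondConfig (Fin n)), MeasurableSet S := fun S => (Set.toFinite S).measurableSet
  have dia := lightnessDiamond w A o x c j hxc
  have sx : μ.real (Rx ∩ Rc) + μ.real (Rx \ Rc) = μ.real Rx := measureReal_inter_add_sdiff (hmeas Rc)
  have sc : μ.real (Rc ∩ Rx) + μ.real (Rc \ Rx) = μ.real Rc := measureReal_inter_add_sdiff (hmeas Rx)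
  have eC : μ.real (Rc ∩ Rx) = μ.real (Rx ∩ Rc) := by rw [inter_comm]
  have eF : μ.real (Rx \ Rc) = μ.real (Rx ∩ Rcᶜ) := rfl
  have eG : μ.real (Rc \ Rx) = μ.real (Rxᶜ ∩ Rc) := by rw [show Rc \ Rx = Rc ∩ Rxᶜ from rfl, inter_comm]
  have hFG : μ.real (Rx ∩ Rcᶜ) ≤ μ.real (Rxᶜ ∩ Rc) := by linarith
  have hL0 : 0 ≤ μ.real (Q ∩ Rx ∩ Rcᶜ) := measureReal_nonneg
  have hF0 : 0 ≤ μ.real (Rx ∩ Rcᶜ) := measureReal_nonneg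
  have hLF : μ.real (Q ∩ Rx ∩ Rcᶜ) ≤ μ.real (Rx ∩ Rcᶜ) := by
    refine measureReal_mono ?_ (measure_ne_top _ _)
    intro ω hω; exact ⟨hω.1.2, hω.2⟩
  have hR0 : 0 ≤ μ.real (Q ∩ Rxᶜ ∩ Rc) := measureReal_nonneg
  rcases hF0.eq_or_lt with hF | hF
  · linarith
  · have h2 : μ.real (Q ∩ Rx ∩ Rcᶜ) * μ.real (Rx ∩ Rcᶜ) ≤
        μ.real (Q ∩ Rx ∩ Rcᶜ) * μ.real (Rxᶜ ∩ Rc) := mul_le_mul_of_nonneg_left hFG hL0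
    exact le_of_mul_le_mul_right (h2.trans dia) hF

end CILFiveTwoConst

open CILFiveTwoConst

/-- **`CIL` at the half level with constant `|A|/2`.**  For `1 ≤ j`, `2 ≤ |A| ≤ 2j+1`, a champion `c ∈ A` at level `j` and any
observer `o`: `μ(1 ≤ |π(o)| ≤ j) ≤ (|A|/2) · μ(|π(c)| ≤ j)`.  Ingredients: Theorem A (`lonelyObserver_le_bigBlock`) for the singleton pockets,
the summed star cuts (`reach_light_heavy_le'`, lightness diamond + champion row) counted with multiplicity `|π(o)| ≥ 2` on the multi-relay pockets and `≤ |A| − 1` on the giant side,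
and the counting lemma `halfLeSevenForms_mul_measureReal_le_sum_inter`. [this file; cite: VandenbergHaggstromKahn2005, Thm. 1.5 (p. 7) via the imports]  Ingredients: Theorem A (`lonelyObserver_le_bigBlock`) for the singleton pockets, the
summed star cuts (`reach_light_heavy_le'`) for the pair pockets, and the counting
lemma `halfLeSevenForms_mul_measureReal_le_sum_inter`. [this file; cite: VandenbergHaggstromKahn2005, Thm. 1.5 (p. 7) via the imports] -/
theorem cil_halfLevel_le_half_card (w : Sym2 (Fin n) → unitInterval) (A : Finset (Fin n)) (o c : Fin n) (j : ℕ)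
    (hj : 1 ≤ j) (hA2 : 2 ≤ A.card) (hA : A.card ≤ 2 * j + 1) (hc : c ∈ A)
    (hmax : ∀ a ∈ A,
      (prodBernoulli w).real {ω : BondConfig (Fin n) | (A.filter fun z => ω ∈ openConn a z).card ≤ j} ≤
        (prodBernoulli w).real {ω : BondConfig (Fin n) | (A.filter fun z => ω ∈ openConn c z).card ≤ j}) :
    (prodBernoulli w).real {ω : BondConfig (Fin n) |
        1 ≤ (A.filter fun z => ω ∈ openConn o z).card ∧ (A.filter fun z => ω ∈ openConn o z).card ≤ j} ≤
      (A.card : ℝ) / 2 * (prodBernoulli w).real {ω : BondConfig (Fin n) | (A.filter fun z => ω ∈ openConn c z).card ≤ j} := by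
  set μ := prodBernoulli w with hμ
  have hmeas : ∀ s : Set (BondConfig (Fin n)), MeasurableSet s := fun _ => MeasurableSet.of_discrete
  -- notation: `No ω = |π(o)|`, `Nc ω = |π(c)|`, `R x = {|π(x)| ≤ j}`
  set No : BondConfig (Fin n) → ℕ := fun ω => (A.filter fun z => ω ∈ openConn o z).card with hNo
  set Nc : BondConfig (Fin n) → ℕ := fun ω => (A.filter fun z => ω ∈ openConn c z).card with hNc
  set R : Fin n → Set (BondConfig (Fin n)) := fun x => {ω | (A.filter fun z => ω ∈ openConn x z).card ≤ j} with hR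
  set L : Set (BondConfig (Fin n)) := {ω | 1 ≤ No ω ∧ No ω ≤ j} with hL
  set La : Set (BondConfig (Fin n)) := {ω | 1 ≤ No ω ∧ No ω ≤ j ∧ Nc ω ≤ j} with hLa
  set B1 : Set (BondConfig (Fin n)) := {ω | No ω = 1 ∧ ¬ Nc ω ≤ j} with hB1
  set B2 : Set (BondConfig (Fin n)) := {ω | 2 ≤ No ω ∧ No ω ≤ j ∧ ¬ Nc ω ≤ j} with hB2
  set Gd : Set (BondConfig (Fin n)) := {ω | j + 1 ≤ No ω ∧ ω ∉ openConn o c} with hGd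
  set Gl : Set (BondConfig (Fin n)) := {ω | j + 1 ≤ No ω ∧ Nc ω ≤ j} with hGl
  -- (1) split of `L`
  have hsplit : L ⊆ La ∪ B1 ∪ B2 := by
    intro ω hω
    rcases hω with ⟨h1, h2⟩
    by_cases hcl : Nc ω ≤ j
    · exact Or.inl (Or.inl ⟨h1, h2, hcl⟩)
    · rcases Nat.lt_or_ge (No ω) 2 with hlt | hge
      · exact Or.inl (Or.inr ⟨by omega, hcl⟩)
      · exact Or.inr ⟨hge, h2, hcl⟩
  have hu1 : μ.real (La ∪ B1 ∪ B2) ≤ μ.real (La ∪ B1) + μ.real B2 := measureReal_union_le _ _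
  have hu2 : μ.real (La ∪ B1) ≤ μ.real La + μ.real B1 := measureReal_union_le _ _
  have hu0 : μ.real L ≤ μ.real (La ∪ B1 ∪ B2) := measureReal_mono hsplit (measure_ne_top _ _)
  have hL_le : μ.real L ≤ μ.real La + μ.real B1 + μ.real B2 := by linarith
  -- (2) Theorem A for the singleton pockets
  have hB1eq : B1 = {ω : BondConfig (Fin n) | No ω = 1 ∧ j + 1 ≤ Nc ω} := by
    ext ω; simp only [mem_setOf_eq]; constructor <;> rintro ⟨h1, h2⟩ <;> exact ⟨h1, by omega⟩
  have hB1 : μ.real B1 ≤ μ.real Gd := by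
    rw [hB1eq]; exact lonelyObserver_le_bigBlock w A o c j hj hc hmax
  -- (3) `Gd ⊆ Gl ⊆ R c` and `La ⊆ R c`, `La ∩ Gl = ∅`
  have hGdGl : Gd ⊆ Gl := by
    intro ω hω
    refine ⟨hω.1, ?_⟩
    have := card_add_card_le A o c hω.2
    show Nc ω ≤ j
    have h5 : No ω + Nc ω ≤ 2 * j + 1 := this.trans hA
    have h6 : j + 1 ≤ No ω := hω.1
    omega
  have hGlR : Gl ⊆ R c := fun ω hω => hω.2
  have hLaR : La ⊆ R c := fun ω hω => hω.2.2
  have hLaGl : Disjoint La Gl := by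
    rw [Set.disjoint_left]
    intro ω h1 h2
    have := h1.2.1; have := h2.1; omega
  have hsum1 : μ.real La + μ.real Gl ≤ μ.real (R c) := by
    rw [← measureReal_union hLaGl (hmeas _)]
    exact measureReal_mono (union_subset hLaR hGlR) (measure_ne_top _ _)
  -- (4) the pair pockets: `2 μ(B2) ≤ Σ_x μ({o↔x} ∩ R_x ∩ R_cᶜ) ≤ Σ_x μ({o↔x} ∩ R_xᶜ ∩ R_c) ≤ 4 μ(Gl)`
  set S : Fin n → Set (BondConfig (Fin n)) := fun x =>
    (openConn o x : Set (BondConfig (Fin n))) ∩ R x ∩ (R c)ᶜ with hS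
  set S' : Fin n → Set (BondConfig (Fin n)) := fun x =>
    (openConn o x : Set (BondConfig (Fin n))) ∩ (R x)ᶜ ∩ R c with hS'
  -- pointwise: on `{No ≤ 2, c heavy}` every relay of `π(o)` lies in `A ∖ c` and contributes to the indicator sum
  have hfib : ∀ ω : BondConfig (Fin n), ¬ Nc ω ≤ j → No ω ≤ j →
      ((No ω : ℕ) : ℝ) ≤ ∑ k ∈ A.erase c, (S k).indicator (fun _ => (1 : ℝ)) ω := by
    intro ω hcH hN2
    have hsub : (A.filter fun z => ω ∈ openConn o z) ⊆ (A.erase c).filter fun x => ω ∈ S x := by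
      intro z hz
      have hzA : z ∈ A := (Finset.mem_filter.1 hz).1
      have hoz : ω ∈ (openConn o z : Set (BondConfig (Fin n))) := (Finset.mem_filter.1 hz).2
      have hpz : (A.filter fun y => ω ∈ openConn z y) = (A.filter fun y => ω ∈ openConn o y) :=
        (filter_eq_of_openConn A o z hoz).symm
      have hz2 : (A.filter fun y => ω ∈ openConn z y).card ≤ j := by rw [hpz]; exact hN2
      have hzc : z ≠ c := by
        intro h
        apply hcH
        show (A.filter fun y => ω ∈ openConn c y).card ≤ j
        simpa [h] using hz2
      refine Finset.mem_filter.2 ⟨Finset.mem_erase.2 ⟨hzc, hzA⟩, ?_⟩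
      exact ⟨⟨hoz, hz2⟩, hcH⟩
    have hcard : No ω ≤ ((A.erase c).filter fun x => ω ∈ S x).card := Finset.card_le_card hsub
    have hsumind : ∑ k ∈ A.erase c, (S k).indicator (fun _ => (1 : ℝ)) ω =
        (((A.erase c).filter fun x => ω ∈ S x).card : ℝ) := by
      rw [Finset.card_filter, Nat.cast_sum]
      refine Finset.sum_congr rfl fun x _ => ?_
      by_cases hx : ω ∈ S x
      · simp [hx]
      · simp [hx]
    rw [hsumind]
    exact_mod_cast hcard
  have hcount1 : (1 : ℝ) * μ.real B1 ≤ ∑ x ∈ A.erase c, μ.real (B1 ∩ S x) := by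
    refine halfLeSevenForms_mul_measureReal_le_sum_inter μ (A.erase c) S (fun _ _ => hmeas _) (hmeas B1) 1 ?_
    rintro ω ⟨hN1, hcH⟩
    have := hfib ω hcH (by omega)
    have h1 : ((No ω : ℕ) : ℝ) = 1 := by rw [hN1]; norm_num
    linarith
  have hcount2 : (2 : ℝ) * μ.real B2 ≤ ∑ x ∈ A.erase c, μ.real (B2 ∩ S x) := by
    refine halfLeSevenForms_mul_measureReal_le_sum_inter μ (A.erase c) S (fun _ _ => hmeas _) (hmeas B2) 2 ?_
    rintro ω ⟨hN2, hNj, hcH⟩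
    have := hfib ω hcH hNj
    have h2 : (2 : ℝ) ≤ ((No ω : ℕ) : ℝ) := by exact_mod_cast hN2
    linarith
  have hB12 : Disjoint B1 B2 := by
    rw [Set.disjoint_left]
    intro ω h1 h2
    have := h1.1; have := h2.1; omega
  have hcount : μ.real B1 + 2 * μ.real B2 ≤ ∑ x ∈ A.erase c, μ.real (S x) := by
    have hle : ∀ x ∈ A.erase c, μ.real (B1 ∩ S x) + μ.real (B2 ∩ S x) ≤ μ.real (S x) := by
      intro x _
      rw [← measureReal_union (hB12.mono inter_subset_left inter_subset_left) (hmeas _)]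
      exact measureReal_mono (union_subset inter_subset_right inter_subset_right) (measure_ne_top _ _)
    have := Finset.sum_le_sum hle
    rw [Finset.sum_add_distrib] at this
    linarith
  have hstar : ∑ x ∈ A.erase c, μ.real (S x) ≤ ∑ x ∈ A.erase c, μ.real (S' x) :=
    Finset.sum_le_sum fun x hx =>
      reach_light_heavy_le' w A o x c j (Finset.ne_of_mem_erase hx) (hmax x (Finset.mem_of_mem_erase hx))
  have hS'le : ∀ x ∈ A.erase c, μ.real (S' x) ≤ μ.real Gl := by
    intro x hx
    refine measureReal_mono ?_ (measure_ne_top _ _)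
    rintro ω ⟨⟨hox, hxH⟩, hcl⟩
    refine ⟨?_, hcl⟩
    have hpx : (A.filter fun y => ω ∈ openConn x y) = (A.filter fun y => ω ∈ openConn o y) :=
      (filter_eq_of_openConn A o x hox).symm
    have : ¬ (A.filter fun y => ω ∈ openConn x y).card ≤ j := hxH
    show j + 1 ≤ (A.filter fun y => ω ∈ openConn o y).card
    rw [← hpx]; omega
  have hcardA : ((A.erase c).card : ℝ) = (A.card : ℝ) - 1 := by
    rw [Finset.card_erase_of_mem hc, Nat.cast_sub (Finset.card_pos.2 ⟨c, hc⟩), Nat.cast_one]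
  have hS'sum : ∑ x ∈ A.erase c, μ.real (S' x) ≤ ((A.card : ℝ) - 1) * μ.real Gl := by
    have := Finset.sum_le_card_nsmul (A.erase c) (fun x => μ.real (S' x)) (μ.real Gl) hS'le
    rw [nsmul_eq_mul, hcardA] at this
    exact this
  -- (5) assemble: bad₁ ≤ G, bad₁ + 2 bad₂ ≤ (k-1) G  ⇒  La + bad₁ + bad₂ ≤ (La + G) + (k/2 - 1) G ≤ (k/2) μ(R_c)
  have hGd' : μ.real Gd ≤ μ.real Gl := measureReal_mono hGdGl (measure_ne_top _ _)
  have hGlR' : μ.real Gl ≤ μ.real (R c) := measureReal_mono hGlR (measure_ne_top _ _)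
  have hB1G : μ.real B1 ≤ μ.real Gl := hB1.trans hGd'
  have h4 : μ.real B1 + 2 * μ.real B2 ≤ ((A.card : ℝ) - 1) * μ.real Gl := hcount.trans (hstar.trans hS'sum)
  have hLa0 : 0 ≤ μ.real La := measureReal_nonneg
  have hGl0 : 0 ≤ μ.real Gl := measureReal_nonneg
  have hRc0 : 0 ≤ μ.real (R c) := measureReal_nonneg
  have hk2 : (2 : ℝ) ≤ (A.card : ℝ) := by exact_mod_cast hA2
  have e1 : ((A.card : ℝ) - 1) * μ.real Gl = (A.card : ℝ) * μ.real Gl - μ.real Gl := by ring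
  have e2 : ((A.card : ℝ) / 2 - 1) * μ.real Gl = (A.card : ℝ) * μ.real Gl / 2 - μ.real Gl := by ring
  have hB12le : 2 * (μ.real B1 + μ.real B2) ≤ (A.card : ℝ) * μ.real Gl := by linarith
  calc μ.real L ≤ μ.real La + μ.real B1 + μ.real B2 := hL_le
    _ ≤ (μ.real La + μ.real Gl) + ((A.card : ℝ) / 2 - 1) * μ.real Gl := by linarith
    _ ≤ μ.real (R c) + ((A.card : ℝ) / 2 - 1) * μ.real (R c) :=
        add_le_add hsum1 (mul_le_mul_of_nonneg_left hGlR' (by linarith))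
    _ = (A.card : ℝ) / 2 * μ.real (R c) := by ring

/-- **`CIL(5,2)` with constant `5/2`.**  For `|A| = 5`, a champion `c ∈ A` at level `2` and any observer `o`:
`μ(1 ≤ |π(o)| ≤ 2) ≤ (5/2) · μ(|π(c)| ≤ 2)` — the open rung up to the factor `5/2`, for every weighted graph. [this file] -/
theorem cil_five_two_le (w : Sym2 (Fin n) → unitInterval) (A : Finset (Fin n)) (o c : Fin n)
    (hA : A.card = 5) (hc : c ∈ A)
    (hmax : ∀ a ∈ A,
      (prodBernoulli w).real {ω : BondConfig (Fin n) | (A.filter fun z => ω ∈ openConn a z).card ≤ 2} ≤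
        (prodBernoulli w).real {ω : BondConfig (Fin n) | (A.filter fun z => ω ∈ openConn c z).card ≤ 2}) :
    (prodBernoulli w).real {ω : BondConfig (Fin n) |
        1 ≤ (A.filter fun z => ω ∈ openConn o z).card ∧ (A.filter fun z => ω ∈ openConn o z).card ≤ 2} ≤
      5 / 2 * (prodBernoulli w).real {ω : BondConfig (Fin n) | (A.filter fun z => ω ∈ openConn c z).card ≤ 2} := by
  have h2 : 2 ≤ A.card := by omega
  have h5 : A.card ≤ 2 * 2 + 1 := by omega
  have h := cil_halfLevel_le_half_card w A o c 2 (by norm_num) h2 h5 hc hmax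
  have hc5 : (A.card : ℝ) = 5 := by exact_mod_cast hA
  simpa [hc5] using h

end Summit.CriticalPhenomena.PercolationContinuityZ3.Theorems

end
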